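import Literature.IUT.LogThetaLattice.LatticeGlueOfKitsWithRealifiedD
import Literature.IUT.LogThetaLattice.LatticeGlueKummerCoherent
import HarnessLib

/-!
# [IUTchIII] Prop 2.1 (vi) / Thm 1.5 (v) / Cor 2.3 (iv) for the companion glue `LatticeGlueKit.withRealifiedD` — proof-only complements

Mochizuki, *Inter-universal Teichmüller Theory III*, kurims manuscript (May 2020), §1 Thm 1.5 (v) pp.50–51, §2 Prop 2.1 (vi) pp.60–61,
Cor 2.3 (iv) p.75 («stabilized/equivariant/functorial with respect to arbitrary automorphisms»); *II* (Dec 2020) Cor 4.6 (ii) p.138,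
Cor 4.10 (v) p.161. [claim: Mochizuki2012, status: disputed] (D-0012 claim key). abc-iut cell, seat abc-iut-w5-d043 (gen 4); PROOF-ONLY
complement (0 defs, 0 instances) to abc-iut-w4-d005's `LatticeGlueOfKitsWithRealifiedD.lean` (`LatticeGlueKit.withRealifiedD`, the
transported companion glue Kummer-coherent) and `BiCoresOfKitsWithRealifiedD.lean` (p433049) — row «`BiCoricKit.withRealifiedD`» of the
zone owner abc-iut-L6-t3; nothing of those files is edited or restated.

WHAT IS ADDED (no hypothesis beyond the kit data by name), for ANY glue kit `Gk : LatticeGlueKit hR X` and Cor 4.5 (ii) inputs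
`(line, c, hc)`:
* `LatticeGlue.ofKits_withRealifiedD_kummerCoherent_iff` — the UN-transported companion real-frame glue
  `LatticeGlue.ofKits … (Gk.withRealifiedD line c hc)` is Kummer-coherent IFF the ONE kit-level Prop 2.1 (vi) square holds at a
  representative Hodge theater `H₀` (abc-iut-L6-t3's `LatticeGlue.ofKits_kummerCoherent_iff` with its second conjunct — the Thm 1.5 (v)
  `ℝ_{>0}`-orbit law — now a theorem): the Prop 2.1 (vi) square is the ONLY kit-level input left for the companion WITHOUT transport;
* `LatticeGlue.ofKits_withRealifiedD_realifiedTransport_conj` — [IUTchIII] Cor 2.3 (iv): the transported poly-isomorphism of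
  Frobenius-like realified data `(^{A}C^⊩_△, …) ⥲ (^{B}C^⊩_△, …)` of the companion glue is FUNCTORIAL in arbitrary isomorphisms of Hodge
  theaters at both ends (abc-iut-L6-t3's `realifiedTransport_conj`, law discharged), in particular STABILIZED by automorphisms;
* `LatticeGlue.ofKits_withRealifiedD_thm15v_singleIso_lattice` — abc-iut-w4-d006's lattice display with `hv` DISCHARGED: along ANY
  log-theta-lattice diagram over the companion glue the bi-coric realified poly-isomorphism between `^{p}𝔇^⊢_△` and `^{q}𝔇^⊢_△` is the
  single `D^⊩(d)`; `…_thm15v_vertical_eq_single` — the realified image of every VERTICAL arrow IS that single isomorphism;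
  `…_thm15v_orbit_compat_horizontal` — for every constituent of a HORIZONTAL arrow the transported class is the double `ℝ_{>0}`-orbit
  class of the single `D^⊩(d_Φ)` (w4-d006's displays, `hv` discharged).

Honest framing: bookkeeping over landed interfaces; which realified datum / Cor 4.10 (iv) identification the GENUINE kits carry stays
abc-iut-L6-t2's / abc-iut-L5's input BY NAME; no side taken on [IUTchIII] Cor 3.12; typed ≠ proved.
-/

noncomputable section

namespace Literature.IUT.LogThetaLattice

open CategoryTheory
open Literature.IUT.HodgeTheaters Literature.IUT.HodgeTheaters.PMBaseKit Literature.IUT.HodgeArakelov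
open Literature.AnabelianGeometry.AbsoluteAnabelian AsSmallTransport

universe u

variable {l : ℕ} {K : PMBaseKit.{u} l} {M : K.MultKit} {FK : K.FKit M}

section Glue

variable (L : FK.MonoLaws) (hbij : FK.IsomFtoDBijective) (hsurj : FK.IsomFmtoDmSurjective) (hR : FK.RlfOfIsStrip)
  (X : TimesMuSide FK L)
  (h : ∀ A B : X.Fglxm, Function.Surjective (fun g : A ≅ B => (X.FglxmToFvtxm ⋙ X.FvtxmToFxm).mapIso g))
  (Gk : LatticeGlueKit hR X) (line : M.DMono → K.V → RLine.{u}) (c : K.V → ℝ) (hc : ∀ v, 0 < c v)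

/-- **IUTchIII:Prop2.1(vi)** (kurims p.61) with **Thm 1.5 (v)** (p.51): the UN-transported companion real-frame glue is Kummer-coherent IFF the
ONE kit-level Prop 2.1 (vi) square holds at one representative Hodge theater `H₀` (abc-iut-L6-t3's `LatticeGlue.ofKits_kummerCoherent_iff`,
whose second conjunct — the `ℝ_{>0}`-orbit law — is a THEOREM for the companion, abc-iut-w4-d005's `withRealifiedD_realifiedKummer_map`).
[claim: Mochizuki2012, status: disputed] -/
theorem LatticeGlue.ofKits_withRealifiedD_kummerCoherent_iff (H₀ : HTRep FK) :
    (LatticeGlue.ofKits L hbij hsurj hR X h (Gk.withRealifiedD line c hc)).KummerCoherent ↔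
      (Gk.linkKit.unitPortion LatticeKind.nonGaussian).app H₀ ≪≫
            (X.FglxmToFvtxm ⋙ X.FvtxmToFxm).mapIso (Gk.pilotEnv_iso.app H₀) ≪≫
              (X.FglxmToFvtxm ⋙ X.FvtxmToFxm).mapIso (X.FglToFglxm.mapIso (Gk.thetaMonoidKit.kummerFgl.app H₀)) =
          ((Gk.fxmDeltaHT_iso.app H₀).symm ≪≫ Gk.biCoricKit.kummer.app H₀) ≪≫
            ((Gk.fxmDeltaD_iso.app (HTRep.toDFunctor.obj H₀)).symm ≪≫
              Gk.thetaMonoidKit.unitPortionD.app (HTRep.toDFunctor.obj H₀)) := by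
  refine (LatticeGlue.ofKits_kummerCoherent_iff L hbij hsurj hR X h (Gk.withRealifiedD line c hc) H₀).trans ?_
  exact ⟨fun hh => hh.1,
    fun hh => ⟨hh, fun ξ e he => Gk.biCoricKit.withRealifiedD_realifiedKummer_map line c hc ξ e he⟩⟩

/-- **IUTchIII:Prop2.1(vi)** (kurims p.61) … in particular: if the kit-level Prop 2.1 (vi) square holds at one `H₀`, the UN-transported companion
glue is Kummer-coherent (nothing else to check). [claim: Mochizuki2012, status: disputed] -/
theorem LatticeGlue.ofKits_withRealifiedD_kummerCoherent_of_square (H₀ : HTRep FK)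
    (hsq : (Gk.linkKit.unitPortion LatticeKind.nonGaussian).app H₀ ≪≫
            (X.FglxmToFvtxm ⋙ X.FvtxmToFxm).mapIso (Gk.pilotEnv_iso.app H₀) ≪≫
              (X.FglxmToFvtxm ⋙ X.FvtxmToFxm).mapIso (X.FglToFglxm.mapIso (Gk.thetaMonoidKit.kummerFgl.app H₀)) =
          ((Gk.fxmDeltaHT_iso.app H₀).symm ≪≫ Gk.biCoricKit.kummer.app H₀) ≪≫
            ((Gk.fxmDeltaD_iso.app (HTRep.toDFunctor.obj H₀)).symm ≪≫
              Gk.thetaMonoidKit.unitPortionD.app (HTRep.toDFunctor.obj H₀))) :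
    (LatticeGlue.ofKits L hbij hsurj hR X h (Gk.withRealifiedD line c hc)).KummerCoherent :=
  (LatticeGlue.ofKits_withRealifiedD_kummerCoherent_iff L hbij hsurj hR X h Gk line c hc H₀).mpr hsq

/-- **IUTchIII:Cor2.3(iv)** (kurims p.75) ← **Thm 1.5 (v)** (p.51): for the companion real-frame glue the transported poly-isomorphism of
Frobenius-like realified data `(^{A}C^⊩_△, …) ⥲ (^{B}C^⊩_△, …)` is FUNCTORIAL in arbitrary isomorphisms of Hodge theaters at both ends —
conjugating by `α : A ≅ A'`, `β : B ≅ B'` gives the transported poly-isomorphism from `A'` to `B'` (abc-iut-L6-t3's `realifiedTransport_conj`,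
law discharged by abc-iut-w4-d005's `ofKits_withRealifiedD_realifiedKummer_map`). [claim: Mochizuki2012, status: disputed] -/
theorem LatticeGlue.ofKits_withRealifiedD_realifiedTransport_conj
    {A A' B B' : (StripFrame.ofKits L hbij hsurj hR X).HT} (α : A ≅ A') (β : B ≅ B') :
    ((PolyIso.single ((LatticeGlue.ofKits L hbij hsurj hR X h (Gk.withRealifiedD line c hc)).biCoric.realifiedHT.mapIso α).symm).comp
          ((LatticeGlue.ofKits L hbij hsurj hR X h (Gk.withRealifiedD line c hc)).biCoric.realifiedTransport A B)).comp
        (PolyIso.single ((LatticeGlue.ofKits L hbij hsurj hR X h (Gk.withRealifiedD line c hc)).biCoric.realifiedHT.mapIso β)) =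
      (LatticeGlue.ofKits L hbij hsurj hR X h (Gk.withRealifiedD line c hc)).biCoric.realifiedTransport A' B' :=
  (LatticeGlue.ofKits L hbij hsurj hR X h (Gk.withRealifiedD line c hc)).biCoric.realifiedTransport_conj
    (fun ξ e he => ofKits_withRealifiedD_realifiedKummer_map L hbij hsurj hR X Gk.biCoricKit line c hc ξ e he) α β

/-- **IUTchIII:Cor2.3(iv)** (kurims p.75) in particular the transported poly-isomorphism of the companion glue is STABILIZED by the automorphisms
induced by arbitrary automorphisms of the two Hodge theaters. [claim: Mochizuki2012, status: disputed] -/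
theorem LatticeGlue.ofKits_withRealifiedD_realifiedTransport_stabilized
    {A B : (StripFrame.ofKits L hbij hsurj hR X).HT} (α : A ≅ A) (β : B ≅ B) :
    ((PolyIso.single ((LatticeGlue.ofKits L hbij hsurj hR X h (Gk.withRealifiedD line c hc)).biCoric.realifiedHT.mapIso α).symm).comp
          ((LatticeGlue.ofKits L hbij hsurj hR X h (Gk.withRealifiedD line c hc)).biCoric.realifiedTransport A B)).comp
        (PolyIso.single ((LatticeGlue.ofKits L hbij hsurj hR X h (Gk.withRealifiedD line c hc)).biCoric.realifiedHT.mapIso β)) =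
      (LatticeGlue.ofKits L hbij hsurj hR X h (Gk.withRealifiedD line c hc)).biCoric.realifiedTransport A B :=
  LatticeGlue.ofKits_withRealifiedD_realifiedTransport_conj L hbij hsurj hR X h Gk line c hc α β

variable (Λ : LogThetaLatticeDiagram (LatticeGlue.ofKits L hbij hsurj hR X h (Gk.withRealifiedD line c hc)).logData
  (LatticeGlue.ofKits L hbij hsurj hR X h (Gk.withRealifiedD line c hc)).linkData)

/-- **IUTchIII:Thm1.5(v)** (kurims p.50) along ANY log-theta-lattice diagram over the companion real-frame glue, the bi-coric realified
poly-isomorphism between `^{p}𝔇^⊢_△` and `^{q}𝔇^⊢_△` is the SINGLE isomorphism `D^⊩(d)` (abc-iut-w4-d006's `thm15v_singleIso_lattice` with its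
rigidity hypothesis `hv` DISCHARGED by abc-iut-w4-d005's `realifiedRigidAt_ofKits_withRealifiedD`). [claim: Mochizuki2012, status: disputed] -/
theorem LatticeGlue.ofKits_withRealifiedD_thm15v_singleIso_lattice (p q : ℤ × ℤ) :
    (LatticeGlue.ofKits L hbij hsurj hR X h (Gk.withRealifiedD line c hc)).biCoric.biCoricRealifiedPolyIso
        ((StripFrame.ofKits L hbij hsurj hR X).htToD.obj (Λ.HT p)) ((StripFrame.ofKits L hbij hsurj hR X).htToD.obj (Λ.HT q)) =
      PolyIso.single ((LatticeGlue.ofKits L hbij hsurj hR X h (Gk.withRealifiedD line c hc)).biCoric.realified.mapIso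
        ((LatticeGlue.ofKits L hbij hsurj hR X h (Gk.withRealifiedD line c hc)).biCoric.dvDelta.mapIso
          ((StripFrame.ofKits L hbij hsurj hR X).iso_nonempty_DHT
            ((StripFrame.ofKits L hbij hsurj hR X).htToD.obj (Λ.HT p))
            ((StripFrame.ofKits L hbij hsurj hR X).htToD.obj (Λ.HT q))).some)) :=
  (LatticeGlue.ofKits L hbij hsurj hR X h (Gk.withRealifiedD line c hc)).thm15v_singleIso_lattice Λ
    (fun _ _ => realifiedRigidAt_ofKits_withRealifiedD L hbij hsurj hR X Gk.biCoricKit line c hc _ _) p q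

/-- **IUTchIII:Thm1.5(v)** (kurims p.50) «bi-coric» — VERTICAL arrows: along ANY log-theta-lattice diagram over the companion real-frame glue,
the realified image of the `𝒟^⊢_△`-poly-isomorphism induced by the vertical (log-link) arrow `(n,m) → (n,m+1)` IS the single `D^⊩(d)` (abc-iut-w4-d006's
`thm15v_of_vertical` — nonempty and inside the bi-coric realified poly-isomorphism — sharpened by the single-iso display).
[claim: Mochizuki2012, status: disputed] -/
theorem LatticeGlue.ofKits_withRealifiedD_thm15v_vertical_eq_single (n m : ℤ) :
    (((Λ.vertical n m).inducedDHT).map (LatticeGlue.ofKits L hbij hsurj hR X h (Gk.withRealifiedD line c hc)).biCoric.dvDelta).map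
        (LatticeGlue.ofKits L hbij hsurj hR X h (Gk.withRealifiedD line c hc)).biCoric.realified =
      PolyIso.single ((LatticeGlue.ofKits L hbij hsurj hR X h (Gk.withRealifiedD line c hc)).biCoric.realified.mapIso
        ((LatticeGlue.ofKits L hbij hsurj hR X h (Gk.withRealifiedD line c hc)).biCoric.dvDelta.mapIso
          ((StripFrame.ofKits L hbij hsurj hR X).iso_nonempty_DHT
            ((StripFrame.ofKits L hbij hsurj hR X).htToD.obj (Λ.HT (n, m)))
            ((StripFrame.ofKits L hbij hsurj hR X).htToD.obj (Λ.HT (n, m + 1)))).some)) := by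
  obtain ⟨hne, hsub⟩ := (LatticeGlue.ofKits L hbij hsurj hR X h (Gk.withRealifiedD line c hc)).thm15v_of_vertical Λ n m
  rw [LatticeGlue.ofKits_withRealifiedD_thm15v_singleIso_lattice L hbij hsurj hR X h Gk line c hc Λ (n, m) (n, m + 1)] at hsub
  exact hne.subset_singleton_iff.mp hsub

/-- **IUTchIII:Thm1.5(v)** (kurims p.51) «compatible … with the `ℝ_{>0}`-orbits» — HORIZONTAL arrows: for every constituent `Φ` of the
horizontal (Θ-link) arrow's poly-isomorphism `(n,m) → (n+1,m)` the transported class between `(^{n,m}C^⊩_△, …)` and `(^{n+1,m}C^⊩_△, …)` of the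
companion glue is the double `ℝ_{>0}`-orbit class of the single `D^⊩(d_Φ)` (abc-iut-w4-d006's `thm15v_orbit_compat_horizontal` with `hv`
DISCHARGED). [claim: Mochizuki2012, status: disputed] -/
theorem LatticeGlue.ofKits_withRealifiedD_thm15v_orbit_compat_horizontal (n m : ℤ)
    {Φ : (LatticeGlue.ofKits L hbij hsurj hR X h (Gk.withRealifiedD line c hc)).linkData.fxmDelta.obj (Λ.HT (n, m)) ≅
      (LatticeGlue.ofKits L hbij hsurj hR X h (Gk.withRealifiedD line c hc)).linkData.fxmDelta.obj (Λ.HT (n + 1, m))}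
    (hΦ : Φ ∈ (LatticeGlue.ofKits L hbij hsurj hR X h (Gk.withRealifiedD line c hc)).linkData.linkInducedFxm Λ.kind
      (Λ.HT (n, m)) (Λ.HT (n + 1, m))) :
    (LatticeGlue.ofKits L hbij hsurj hR X h (Gk.withRealifiedD line c hc)).biCoric.realifiedTransport (Λ.HT (n, m)) (Λ.HT (n + 1, m)) =
      (((LatticeGlue.ofKits L hbij hsurj hR X h (Gk.withRealifiedD line c hc)).biCoric.realifiedKummer (Λ.HT (n, m))).comp
          (PolyIso.single ((LatticeGlue.ofKits L hbij hsurj hR X h (Gk.withRealifiedD line c hc)).biCoric.realified.mapIso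
            ((LatticeGlue.ofKits L hbij hsurj hR X h (Gk.withRealifiedD line c hc)).biCoric.dvConj
              ((LatticeGlue.ofKits L hbij hsurj hR X h (Gk.withRealifiedD line c hc)).biCoric.kummerTransport
                ((LatticeGlue.ofKits L hbij hsurj hR X h (Gk.withRealifiedD line c hc)).fxmDeltaHT_iso.app (Λ.HT (n, m)) ≪≫ Φ ≪≫
                  ((LatticeGlue.ofKits L hbij hsurj hR X h (Gk.withRealifiedD line c hc)).fxmDeltaHT_iso.app
                    (Λ.HT (n + 1, m))).symm)))))).comp
        ((LatticeGlue.ofKits L hbij hsurj hR X h (Gk.withRealifiedD line c hc)).biCoric.realifiedKummer (Λ.HT (n + 1, m))).symm :=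
  (LatticeGlue.ofKits L hbij hsurj hR X h (Gk.withRealifiedD line c hc)).thm15v_orbit_compat_horizontal Λ
    (fun _ _ => realifiedRigidAt_ofKits_withRealifiedD L hbij hsurj hR X Gk.biCoricKit line c hc _ _) n m hΦ

end Glue

end Literature.IUT.LogThetaLattice

end
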